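import Summits.ValiantsHypothesis.ValiantsHypothesis.Theorems.GrenetZeonDualUnipotentThreeHalvesSlowFourSevenSquare
import Summits.ValiantsHypothesis.ValiantsHypothesis.Theorems.GrenetZeonDualUnipotentThreeHalvesSlowFourSevenCube
import Summits.ValiantsHypothesis.ValiantsHypothesis.Theorems.GrenetZeonDualUnipotentThreeHalvesSlowFourSevenLine
import Summits.ValiantsHypothesis.ValiantsHypothesis.Theorems.GrenetZeonDualUnipotentThreeHalvesSlowCoreDefs

/-!
# `GrenetZeon.DualUnipotentThreeHalves` (stmt-ValiantsHypothesis-24318) — successor line `slow_core`, NEGATIVE lane: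
# THE FORMAT `(4, 7)` IS FALSE IN POWER CURRENCY TOO — `¬ Slow 4 7 NSeven`, unconditionally (no coordinate reduction)

Experiment cell «val-heavytop-census» (D-0160), engine seat val-htc-eng-1 g2 (kernel-only lane, director-valiant g17 R315 (4)).
Twin of ✓ `…/Negative/SlowThreeFive` (`¬ Slow 3 5 NFive`).  CENSUS-GRID v0.6b §0 (G) booked the re-decision of the flag-currency ✗ cell
`(4,7)` (✓ p648631 `not_heavyTopInst_four_seven`, far-corner pencil ✓ `NSeven`) in the successor head currency R2ᵖ `HeavyTopSlowLaw`
(conclusion `Slow`, ✓ `…SlowCoreDefs`) «modulo the coordinate-`K` reduction H».  THIS FILE does it WITHOUT any reduction.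

`Slow 4 7 NSeven` asks for `K ≤ ℂ^{4×4}` and `k` with `4(k+1) < dim K ≤ 16` — so `k ≤ 2` — such that every entry of
`N(x + s v)³ = (Q(x) + s·Q(v))³`, `v ∈ K`, has `s`-degree `≤ k` (`Q = topSeven`; entrywise expansion ✓ `cube_apply` of
`…SlowFourSevenLine`).  In every budget the `s³`-coefficient `Q(v)³` vanishes on `K` (take `x = 0`).
* `k = 2` (`dim K ≥ 13`): `Q(v)³ = 0` on `K` is exactly what the word-currency cube tree consumes — ✓ `no_cubeZero_NSeven`
  (`…SlowFourSevenCube`, the tree of ✓ `no_wordTame_two_NSeven` re-plumbed).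
* `k = 1` (`dim K ≥ 9`): the `s²`-coefficient `Q(x)Q(v)² + Q(v)Q(x)Q(v) + Q(v)²Q(x)` vanishes for every top `Q(x)`; at the sixteen
  matrix units this gives (✓ `key_two`) `Q(v)·E·Q(v) = 0` — hence `Q(v)·Q(x)·Q(v) = 0` for ALL tops by linearity (`topSeven_eq_sum`) —
  and the vanishing of rows `1..6` and columns `0..5` of `Q(v)²` off the diagonal, in particular the four square relations at the
  entries `(0,3),(0,4),(0,5),(1,4)`; power currency does NOT give `Q(v)² = 0` (e.g. `v = e₀₃ + e₃₆`: `Q(v)² = E₀₆`), but the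
  budget-one tree needs only these inputs — ✓ `no_squareCorner_NSeven` (`…SlowFourSevenSquare`).
* `k = 0` (`dim K ≥ 5`): the `s`-coefficient `Q(x)²Q(v) + Q(x)Q(v)Q(x) + Q(v)Q(x)²` vanishes for every top; single units give
  nothing (`E² = 0`, `E·Q(v)·E = 0`), but POLARISING along the five unit paths `E_{t,t+1}, E_{t+1,t+2}` (`polar`, ✓ `key_one`) kills
  rows `2..6` and columns `0..4` of `Q(v)`, i.e. all sixteen coordinates: `v = 0`, contradicting `dim K ≥ 5`.

* ★ `not_slow_four_seven : ¬ Slow 4 7 NSeven`, `not_slowR_four_seven`;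
* ★ `not_heavyTopSlowInst_four_seven` — the BODY of R2ᵖ `HeavyTopSlowLaw` at format `(4,7)` fails (heavy-top hypothesis vacuous:
  `dim K ≤ 16 ≤ 16·7·⌊√4⌋ + 64`).

HONEST LABEL.  As for ✓ `not_heavyTopInst_four_seven`: NOT a refutation of R2ᵖ `HeavyTopSlowLaw` (`n₀ ≥ 5` or `C₀ ≥ 2` discards
`(4,7)`); the tiny-`n` data point `C₀ = 1 ∧ n₀ ≤ 4` is inadmissible in BOTH currencies, and the census cells `(3,5)`, `(4,7)` now read
✗ in flag AND power currency in the kernel.  `--supports stmt-ValiantsHypothesis-24318` (Negative lane); 24318, S3, R2ᵖ, IRR, RED,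
rung 8062 and `VP ≠ VNP` are OPEN / NOT proved.  No definitions, no named facts.
[CENSUS-GRID v0.6b §0 (G); ✓ `…/Negative/HeavyTopInstFourSeven` + `…BudgetOne/Blocks/Toolkit/Defs` (val-port-2 g2); ✓ `…SlowCoreDefs`; this seat]
-/

set_option linter.dupNamespace false
set_option autoImplicit false

noncomputable section

namespace Summit.ValiantsHypothesis.ValiantsHypothesis.Theorems.DualUnipotentThreeHalvesNegative.SlowFourSeven

open MvPolynomial Matrix
open scoped BigOperators
open Summit.ValiantsHypothesis.ValiantsHypothesis.Cruxes.TwoDimCoefficients.DimTwoCases (AffMat IsAffine)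
open Summit.ValiantsHypothesis.ValiantsHypothesis.Theorems.GrenetZeon.RadicalSplit
  (lineSubst RadOrth NSeven topSeven isAffine_NSeven NSeven_pow eq_zero_of_topSeven_eq_zero topSeven_single_10 topSeven_single_11
    topSeven_single_20 topSeven_single_21 topSeven_single_30 topSeven_single_31 topSeven_single_13)
open Summit.ValiantsHypothesis.ValiantsHypothesis.Theorems.GrenetZeon.SlowFourSeven
open Summit.ValiantsHypothesis.ValiantsHypothesis.Theorems.GrenetZeon.SlowCore (Slow SlowR slow_of_slowR)

/-! ## §1 Two pieces of algebra -/

/-- Polarisation of the `s`-coefficient `P²B + PBP + BP²` in `P`. -/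
theorem polar (P P' B : Matrix (Fin 7) (Fin 7) ℂ) :
    (P + P') * (P + P') * B + (P + P') * B * (P + P') + B * (P + P') * (P + P') =
      (P * P * B + P * B * P + B * P * P) + (P' * P' * B + P' * B * P' + B * P' * P')
        + ((P * P' + P' * P) * B + P * B * P' + P' * B * P + B * (P * P' + P' * P)) := by
  noncomm_ring

/-- `topSeven` is homogeneous. -/
theorem topSeven_smul (a : ℂ) (x : Fin 4 × Fin 4 → ℂ) : topSeven (a • x) = a • topSeven x := by
  ext i j; fin_cases i <;> fin_cases j <;> simp [topSeven]

/-- The top of `x` is the coordinate combination of the sixteen unit tops. -/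
theorem topSeven_eq_sum (x : Fin 4 × Fin 4 → ℂ) :
    topSeven x = ∑ c : Fin 4 × Fin 4, x c • topSeven (Pi.single c (1 : ℂ)) := by
  have h1 : topSeven x = topSeven (∑ c : Fin 4 × Fin 4, Pi.single c (x c)) := by rw [Finset.univ_sum_single x]
  have h2 : topSeven (∑ c : Fin 4 × Fin 4, Pi.single c (x c)) = ∑ c : Fin 4 × Fin 4, topSeven (Pi.single c (x c)) :=
    map_sum (AddMonoidHom.mk' topSeven topSeven_add) _ _
  rw [h1, h2]
  refine Finset.sum_congr rfl fun c _ => ?_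
  rw [← topSeven_smul]
  congr 1
  ext c'
  by_cases hc : c' = c
  · subst hc; simp
  · simp [hc]

/-! ## §2 The verdict at format `(4, 7)` in power currency -/

set_option maxHeartbeats 800000 in
/-- ★ **`NSeven` is not slow at `n = 4`**: `¬ Slow 4 7 NSeven` (unconditional; no coordinate reduction). [this file] -/
theorem not_slow_four_seven : ¬ Slow 4 7 NSeven := by
  classical
  rintro ⟨K, k, hK', hdim⟩
  have hK : ∀ x v : Fin 4 × Fin 4 → ℂ, v ∈ K → ∀ i j : Fin 7,
      ((((NSeven.map (lineSubst x v)) ^ 3) i j).totalDegree ≤ k) := fun x v hv i j => by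
    simpa using hK' x v hv i j
  have hV16 : Module.finrank ℂ (Fin 4 × Fin 4 → ℂ) = 16 := by simp [Module.finrank_fintype_fun_eq_card]
  have hKle : Module.finrank ℂ K ≤ 16 := by
    have h1 := Submodule.finrank_le K
    omega
  have hk2 : k ≤ 2 := by
    by_contra hk
    have : 4 * 4 ≤ (k + 1) * 4 := Nat.mul_le_mul_right 4 (by omega)
    omega
  have hlow : ∀ v : Fin 4 × Fin 4 → ℂ, ∀ i j : Fin 7, (j : ℕ) ≤ i → topSeven v i j = 0 := topSeven_apply_of_le
  have hdiag : ∀ v : Fin 4 × Fin 4 → ℂ, ∀ i : Fin 7, topSeven v i i = 0 := fun v i => hlow v i i le_rfl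
  -- every budget: the `s³`-coefficient `Q(v)³` vanishes on `K`
  have hcube : ∀ v ∈ K, topSeven v * topSeven v * topSeven v = 0 := by
    intro v hv
    ext i j
    by_contra hne
    have h3 := le_totalDegree_of_coeff_ne_zero (p := ((NSeven.map (lineSubst 0 v)) ^ 3) i j) (e := 3)
      (by rw [coeff_cube_three]; exact hne)
    have h0 := hK 0 v hv i j
    omega
  interval_cases k
  · -- budget 0: `dim K ≥ 5`; the polarised `s`-coefficient kills every coordinate of a non-zero `v ∈ K`
    have hKne : K ≠ ⊥ := by
      intro h; rw [h, finrank_bot] at hdim; omega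
    obtain ⟨v, hvK, hv0⟩ := Submodule.exists_mem_ne_zero_of_ne_bot hKne
    have h1 : ∀ x : Fin 4 × Fin 4 → ℂ, ∀ i j : Fin 7,
        (topSeven x * topSeven x * topSeven v + topSeven x * topSeven v * topSeven x
          + topSeven v * topSeven x * topSeven x) i j = 0 := by
      intro x i j
      by_contra hne
      have h := le_totalDegree_of_coeff_ne_zero (p := ((NSeven.map (lineSubst x v)) ^ 3) i j) (e := 1)
        (by rw [coeff_cube_one]; exact hne)
      have h0 := hK x v hvK i j
      omega
    -- polarise along a path of two units `E_{ab}, E_{bd}`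
    have path : ∀ (c c' : Fin 4 × Fin 4) (a b d : Fin 7), a < d →
        topSeven (Pi.single c (1 : ℂ)) = Matrix.single a b 1 → topSeven (Pi.single c' (1 : ℂ)) = Matrix.single b d 1 →
        (∀ j, j ≠ d → topSeven v d j = 0) ∧ (∀ i, i ≠ a → topSeven v i a = 0) := by
      intro c c' a b d had hc hc'
      have hda : d ≠ a := fun h => by rw [h] at had; exact lt_irrefl _ had
      refine key_one (topSeven v) (hlow v) a b d had fun i j => ?_
      have e1 := h1 (Pi.single c 1) i j
      have e2 := h1 (Pi.single c' 1) i j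
      have e3 := h1 (Pi.single c 1 + Pi.single c' 1) i j
      rw [hc] at e1
      rw [hc'] at e2
      rw [topSeven_add, hc, hc', polar, Matrix.add_apply, Matrix.add_apply, e1, e2, zero_add, zero_add,
        Matrix.single_mul_single_same, Matrix.single_mul_single_of_ne (h := hda), mul_one, add_zero] at e3
      exact e3
    obtain ⟨r2, c0⟩ := path ((0 : Fin 4), (0 : Fin 4)) ((1 : Fin 4), (0 : Fin 4)) 0 1 2 (by decide) top_single_00 topSeven_single_10
    obtain ⟨r3, c1⟩ := path ((1 : Fin 4), (0 : Fin 4)) ((2 : Fin 4), (0 : Fin 4)) 1 2 3 (by decide) topSeven_single_10 topSeven_single_20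
    obtain ⟨r4, c2⟩ := path ((2 : Fin 4), (0 : Fin 4)) ((3 : Fin 4), (0 : Fin 4)) 2 3 4 (by decide) topSeven_single_20 topSeven_single_30
    obtain ⟨r5, c3⟩ := path ((3 : Fin 4), (0 : Fin 4)) ((1 : Fin 4), (3 : Fin 4)) 3 4 5 (by decide) topSeven_single_30 topSeven_single_13
    obtain ⟨r6, c4⟩ := path ((1 : Fin 4), (3 : Fin 4)) ((3 : Fin 4), (3 : Fin 4)) 4 5 6 (by decide) topSeven_single_13 top_single_33
    have hQ : topSeven v = 0 := by
      ext i j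
      rw [Matrix.zero_apply]
      fin_cases i <;> fin_cases j
      · exact hlow v _ _ (by decide)
      · exact c1 _ (by decide)
      · exact c2 _ (by decide)
      · exact c3 _ (by decide)
      · exact c4 _ (by decide)
      · simp [topSeven]
      · simp [topSeven]
      · exact hlow v _ _ (by decide)
      · exact hlow v _ _ (by decide)
      · exact c2 _ (by decide)
      · exact c3 _ (by decide)
      · exact c4 _ (by decide)
      · simp [topSeven]
      · simp [topSeven]
      · exact hlow v _ _ (by decide)
      · exact hlow v _ _ (by decide)
      · exact hlow v _ _ (by decide)
      · exact r2 _ (by decide)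
      · exact r2 _ (by decide)
      · exact r2 _ (by decide)
      · exact r2 _ (by decide)
      · exact hlow v _ _ (by decide)
      · exact hlow v _ _ (by decide)
      · exact hlow v _ _ (by decide)
      · exact hlow v _ _ (by decide)
      · exact r3 _ (by decide)
      · exact r3 _ (by decide)
      · exact r3 _ (by decide)
      · exact hlow v _ _ (by decide)
      · exact hlow v _ _ (by decide)
      · exact hlow v _ _ (by decide)
      · exact hlow v _ _ (by decide)
      · exact hlow v _ _ (by decide)
      · exact r4 _ (by decide)
      · exact r4 _ (by decide)
      · exact hlow v _ _ (by decide)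
      · exact hlow v _ _ (by decide)
      · exact hlow v _ _ (by decide)
      · exact hlow v _ _ (by decide)
      · exact hlow v _ _ (by decide)
      · exact hlow v _ _ (by decide)
      · exact r5 _ (by decide)
      · exact hlow v _ _ (by decide)
      · exact hlow v _ _ (by decide)
      · exact hlow v _ _ (by decide)
      · exact hlow v _ _ (by decide)
      · exact hlow v _ _ (by decide)
      · exact hlow v _ _ (by decide)
      · exact hlow v _ _ (by decide)
    exact hv0 (eq_zero_of_topSeven_eq_zero v hQ)
  · -- budget 1: `dim K ≥ 9`; the `s²`-coefficient gives `Q(v)·P·Q(v) = 0` and the square relations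
    have h2 : ∀ v ∈ K, ∀ x : Fin 4 × Fin 4 → ℂ, ∀ i j : Fin 7,
        (topSeven x * topSeven v * topSeven v + topSeven v * topSeven x * topSeven v
          + topSeven v * topSeven v * topSeven x) i j = 0 := by
      intro v hv x i j
      by_contra hne
      have h := le_totalDegree_of_coeff_ne_zero (p := ((NSeven.map (lineSubst x v)) ^ 3) i j) (e := 2)
        (by rw [coeff_cube_two]; exact hne)
      have h0 := hK x v hv i j
      omega
    have unit : ∀ v ∈ K, ∀ (c : Fin 4 × Fin 4) (a b : Fin 7), topSeven (Pi.single c (1 : ℂ)) = Matrix.single a b 1 →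
        topSeven v * Matrix.single a b 1 * topSeven v = 0 ∧ (∀ j, j ≠ b → (topSeven v * topSeven v) b j = 0) ∧
          (∀ i, i ≠ a → (topSeven v * topSeven v) i a = 0) := by
      intro v hv c a b hc
      refine key_two (topSeven v) (hdiag v) a b fun i j => ?_
      have h := h2 v hv (Pi.single c 1) i j
      rwa [hc] at h
    have hqpq : ∀ x : Fin 4 × Fin 4 → ℂ, ∀ v ∈ K, topSeven v * topSeven x * topSeven v = 0 := by
      intro x v hv
      have s00 : topSeven v * topSeven (Pi.single ((0 : Fin 4), (0 : Fin 4)) (1 : ℂ)) * topSeven v = 0 := by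
        rw [top_single_00]; exact (unit v hv _ 0 1 top_single_00).1
      have s01 : topSeven v * topSeven (Pi.single ((0 : Fin 4), (1 : Fin 4)) (1 : ℂ)) * topSeven v = 0 := by
        rw [top_single_01]; exact (unit v hv _ 0 2 top_single_01).1
      have s02 : topSeven v * topSeven (Pi.single ((0 : Fin 4), (2 : Fin 4)) (1 : ℂ)) * topSeven v = 0 := by
        rw [top_single_02]; exact (unit v hv _ 0 3 top_single_02).1
      have s03 : topSeven v * topSeven (Pi.single ((0 : Fin 4), (3 : Fin 4)) (1 : ℂ)) * topSeven v = 0 := by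
        rw [top_single_03]; exact (unit v hv _ 0 4 top_single_03).1
      have s10 : topSeven v * topSeven (Pi.single ((1 : Fin 4), (0 : Fin 4)) (1 : ℂ)) * topSeven v = 0 := by
        rw [topSeven_single_10]; exact (unit v hv _ 1 2 topSeven_single_10).1
      have s11 : topSeven v * topSeven (Pi.single ((1 : Fin 4), (1 : Fin 4)) (1 : ℂ)) * topSeven v = 0 := by
        rw [topSeven_single_11]; exact (unit v hv _ 1 3 topSeven_single_11).1
      have s12 : topSeven v * topSeven (Pi.single ((1 : Fin 4), (2 : Fin 4)) (1 : ℂ)) * topSeven v = 0 := by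
        rw [top_single_12]; exact (unit v hv _ 1 4 top_single_12).1
      have s13 : topSeven v * topSeven (Pi.single ((1 : Fin 4), (3 : Fin 4)) (1 : ℂ)) * topSeven v = 0 := by
        rw [topSeven_single_13]; exact (unit v hv _ 4 5 topSeven_single_13).1
      have s20 : topSeven v * topSeven (Pi.single ((2 : Fin 4), (0 : Fin 4)) (1 : ℂ)) * topSeven v = 0 := by
        rw [topSeven_single_20]; exact (unit v hv _ 2 3 topSeven_single_20).1
      have s21 : topSeven v * topSeven (Pi.single ((2 : Fin 4), (1 : Fin 4)) (1 : ℂ)) * topSeven v = 0 := by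
        rw [topSeven_single_21]; exact (unit v hv _ 2 4 topSeven_single_21).1
      have s22 : topSeven v * topSeven (Pi.single ((2 : Fin 4), (2 : Fin 4)) (1 : ℂ)) * topSeven v = 0 := by
        rw [top_single_22]; exact (unit v hv _ 2 5 top_single_22).1
      have s23 : topSeven v * topSeven (Pi.single ((2 : Fin 4), (3 : Fin 4)) (1 : ℂ)) * topSeven v = 0 := by
        rw [top_single_23]; exact (unit v hv _ 4 6 top_single_23).1
      have s30 : topSeven v * topSeven (Pi.single ((3 : Fin 4), (0 : Fin 4)) (1 : ℂ)) * topSeven v = 0 := by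
        rw [topSeven_single_30]; exact (unit v hv _ 3 4 topSeven_single_30).1
      have s31 : topSeven v * topSeven (Pi.single ((3 : Fin 4), (1 : Fin 4)) (1 : ℂ)) * topSeven v = 0 := by
        rw [topSeven_single_31]; exact (unit v hv _ 3 5 topSeven_single_31).1
      have s32 : topSeven v * topSeven (Pi.single ((3 : Fin 4), (2 : Fin 4)) (1 : ℂ)) * topSeven v = 0 := by
        rw [top_single_32]; exact (unit v hv _ 3 6 top_single_32).1
      have s33 : topSeven v * topSeven (Pi.single ((3 : Fin 4), (3 : Fin 4)) (1 : ℂ)) * topSeven v = 0 := by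
        rw [top_single_33]; exact (unit v hv _ 5 6 top_single_33).1
      rw [topSeven_eq_sum x, Finset.mul_sum, Finset.sum_mul]
      simp only [Matrix.mul_smul, Matrix.smul_mul, Fintype.sum_prod_type, Fin.sum_univ_four, s00, s01, s02, s03, s10, s11, s12, s13, s20, s21, s22, s23, s30, s31, s32, s33,
        smul_zero, add_zero]
    have sq14 : ∀ v ∈ K, v (0,0) * v (1,1) + v (0,1) * v (2,0) = 0 := fun v hv => by
      have h := (unit v hv _ 3 4 topSeven_single_30).2.2 0 (by decide)
      simp [topSeven, Matrix.mul_apply, Fin.sum_univ_seven, -mul_eq_zero] at h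
      linear_combination h
    have sq15 : ∀ v ∈ K, v (0,0) * v (1,2) + v (0,1) * v (2,1) + v (0,2) * v (3,0) = 0 := fun v hv => by
      have h := (unit v hv _ 4 5 topSeven_single_13).2.2 0 (by decide)
      simp [topSeven, Matrix.mul_apply, Fin.sum_univ_seven, -mul_eq_zero] at h
      linear_combination h
    have sq16 : ∀ v ∈ K, v (0,1) * v (2,2) + v (0,2) * v (3,1) + v (0,3) * v (1,3) = 0 := fun v hv => by
      have h := (unit v hv _ 5 6 top_single_33).2.2 0 (by decide)
      simp [topSeven, Matrix.mul_apply, Fin.sum_univ_seven, -mul_eq_zero] at h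
      linear_combination h
    have sq25 : ∀ v ∈ K, v (1,0) * v (2,1) + v (1,1) * v (3,0) = 0 := fun v hv => by
      have h := (unit v hv _ 4 5 topSeven_single_13).2.2 1 (by decide)
      simp [topSeven, Matrix.mul_apply, Fin.sum_univ_seven, -mul_eq_zero] at h
      linear_combination h
    exact no_squareCorner_NSeven K (by omega) hqpq sq14 sq15 sq16 sq25
  · -- budget 2: `dim K ≥ 13` and cube-zero tops
    exact no_cubeZero_NSeven K (by omega) hcube

/-- `NSeven` is not window-slow either (`SlowR ⇒ Slow`). [this file] -/
theorem not_slowR_four_seven : ¬ SlowR 4 7 NSeven := fun h => not_slow_four_seven (slow_of_slowR h)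

/-- ★ **The format `(4, 7)` of R2ᵖ is FALSE in power currency**: the BODY of `HeavyTopSlowLaw` at `n = 4`, `m = 7` fails on `NSeven`
(admissible for `C₀ = 1`: `49 < 64`; heavy-top hypothesis vacuous at `n = 4`).  NOT a refutation of R2ᵖ (`n₀ ≥ 5` or `C₀ ≥ 2`
discards it). [this file] -/
theorem not_heavyTopSlowInst_four_seven :
    ¬ (∀ N : AffMat 4 7, IsAffine N → N ^ 7 = 0 →
        (∀ K : Submodule ℂ (Fin 4 × Fin 4 → ℂ), RadOrth 4 7 N K →
          Module.finrank ℂ K ≤ 16 * 7 * Nat.sqrt 4 + 16 * 4) →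
        Slow 4 7 N) := by
  intro h
  have hV16 : Module.finrank ℂ (Fin 4 × Fin 4 → ℂ) = 16 := by simp [Module.finrank_fintype_fun_eq_card]
  have hs : Nat.sqrt 4 = 2 := by norm_num [Nat.sqrt_eq']
  refine not_slow_four_seven (h NSeven isAffine_NSeven NSeven_pow fun K _ => ?_)
  have h1 := Submodule.finrank_le K
  rw [hs]; omega

end Summit.ValiantsHypothesis.ValiantsHypothesis.Theorems.DualUnipotentThreeHalvesNegative.SlowFourSeven

end
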